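import Summits.KontsevichZagierPeriods.KontsevichZagierPeriods.Theses.HurwitzMicroSectors
import Literature.NumberTheory.Transcendental.KZKernelConjectureForms
import Summits.KontsevichZagierPeriods.KontsevichZagierPeriods.Theorems.HurwitzMicroSectorsNormalFormPrincipleStubVolumePiBox
import Summits.KontsevichZagierPeriods.KontsevichZagierPeriods.Theorems.HurwitzMicroSectorsNormalFormPrincipleStubBoxPiStable
import Summits.KontsevichZagierPeriods.KontsevichZagierPeriods.Theorems.HurwitzMicroSectorsNormalFormPrincipleStubBoxCombine

/-!
# `NormalFormPrinciple` (stmt-KontsevichZagierPeriods-3869), line `SketchIdeator1` ("π buys geometry") —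
# the transfer theorem: Conjecture 1 ⟺ BoxRigidity ∧ PiCancellation

The sorry-free part of the line's composition, proving the registered sub-goal `statement_of_leaves`.
With the landed stubs (`stub_volumePiBox`: bounded volumes are box-rational up to a power of `[π]`;
`stub_boxPiStable`, `stub_piCalibration`: the box-rational family is `π`-stable; `stub_boxCombine`:
it is closed under differences) every representation `r` satisfies `[π]^k·[r] ≡ [N]` for a
BOX-RATIONAL `N` (domain the open unit box, integrand `p/q` over `ℚ`) — `exists_boxRat_piPow_sub`,
the `PiBoxReduction` of card pi-buys-geometry. Consequently the Kontsevich–Zagier period conjecture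
for the tree's calculus (`KontsevichZagierPeriods`) is EQUIVALENT to the conjunction of
`BoxRigidity` (two box-rational representations with equal values are KZ-equivalent: Conjecture 1
with the domain frozen to the unit box) and `KZ.PiCancellation` (`[π]` is a non-zero-divisor modulo
relations; item stmt-KontsevichZagierPeriods-0540): `statement_iff_leaves`. The forward direction is
soundness plus `KZ.piCancellation_of_kernel`; the backward direction is the reduction, a common power
of `[π]`, values by soundness (`π^T·v`), rigidity, cancellation. Pure proof file.
Source: M. Kontsevich, D. Zagier, *Periods* (2001), §1.2 (Conjecture 1), §4.1 (`P̂ = P[1/2πi]`).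
-/

noncomputable section

open MeasureTheory Set
open Literature.NumberTheory.Transcendental Literature.NumberTheory.Transcendental.KZ
open Literature.ModelTheory.ExponentialFields (IsSemialgebraic)

namespace Summit.KontsevichZagierPeriods.HurwitzMicroSectors.NormalFormPrinciple.PiBox

variable {n m : ℕ}

/-! ## π-stability of the box-rational family -/

/-- `[π]·[N]` is box-rational modulo relations for box-rational `N`: `[π]·[N] ≡ [N]·[π]`
(commutation modulo relations, tree) `≡ [N]·(2•κ) = 2•[N × κ]` (calibration, right ideal)
`≡ [N']` (`stub_boxPiStable`). [folklore] -/
theorem exists_boxRat_piMul (N : IntegralRep m) (hNd : N.domain = {x | ∀ i, x i ∈ Set.Ioo (0:ℝ) 1})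
    (hNr : N.IsRational) :
    ∃ N' : IntegralRep (m + 1), N'.domain = {x | ∀ i, x i ∈ Set.Ioo (0:ℝ) 1} ∧ N'.IsRational ∧
      of piRep * of N - of N' ∈ relations := by
  obtain ⟨κ, hκd, hκi⟩ := exists_kappa
  obtain ⟨N', hN'd, hN'r, hN'⟩ := stub_boxPiStable m N κ hNd hNr hκd hκi
  refine ⟨N', hN'd, hN'r, ?_⟩
  have h1 : of piRep * of N - of N * of piRep ∈ relations := mul_sub_mul_comm_mem_relations _ _
  have h2 : of N * of piRep - of N * (2 • of κ) ∈ relations := by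
    rw [← mul_sub]
    exact mul_mem_relations_left_holds _ _ (stub_piCalibration κ hκd hκi)
  have h3 : of N * (2 • of κ) = 2 • of (N.prod κ) := by
    rw [two_nsmul, two_nsmul, mul_add, of_mul_of]
  have : of piRep * of N - of N' = (of piRep * of N - of N * of piRep) +
      (of N * of piRep - of N * (2 • of κ)) + (2 • of (N.prod κ) - of N') := by
    rw [← h3]; abel
  rw [this]
  exact relations.add_mem (relations.add_mem h1 h2) hN'

/-- Iterated π-stability: `[π]^j·[N] ≡ [N_j]`, `N_j` box-rational. [folklore] -/
theorem exists_boxRat_piPow (j : ℕ) :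
    ∀ (m : ℕ) (N : IntegralRep m), N.domain = {x | ∀ i, x i ∈ Set.Ioo (0:ℝ) 1} → N.IsRational →
    ∃ (m' : ℕ) (N' : IntegralRep m'), N'.domain = {x | ∀ i, x i ∈ Set.Ioo (0:ℝ) 1} ∧ N'.IsRational ∧
      (fun x => of piRep * x)^[j] (of N) - of N' ∈ relations := by
  induction j with
  | zero =>
    intro m N hNd hNr
    exact ⟨m, N, hNd, hNr, by simp [relations.zero_mem]⟩
  | succ j ih =>
    intro m N hNd hNr
    obtain ⟨m₁, N₁, h₁d, h₁r, h₁⟩ := ih m N hNd hNr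
    obtain ⟨N₂, h₂d, h₂r, h₂⟩ := exists_boxRat_piMul N₁ h₁d h₁r
    refine ⟨m₁ + 1, N₂, h₂d, h₂r, ?_⟩
    have h3 : of piRep * (fun x => of piRep * x)^[j] (of N) - of piRep * of N₁ ∈ relations := by
      rw [← piMul_sub]
      exact mul_mem_relations_left_holds _ _ h₁
    simp only [Function.iterate_succ_apply']
    have : of piRep * (fun x => of piRep * x)^[j] (of N) - of N₂ =
        (of piRep * (fun x => of piRep * x)^[j] (of N) - of piRep * of N₁) + (of piRep * of N₁ - of N₂) := by abel
    rw [this]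
    exact relations.add_mem h3 h₂

/-! ## Reduction up to `[π]`: every representation (`PiBoxReduction`) -/

/-- **`PiBoxReduction`**: for every representation `r` there are `k` and a box-rational `N` with
`[π]^k·[r] ≡ [N]`: bounded-volume form `[r] ≡ [A] − [B]` (tree), `stub_volumePiBox` on `A` and `B`,
common power by π-stability, difference by `stub_boxCombine`. [folklore] -/
theorem exists_boxRat_piPow_sub (r : IntegralRep n) :
    ∃ (k m : ℕ) (N : IntegralRep m), N.domain = {x | ∀ i, x i ∈ Set.Ioo (0:ℝ) 1} ∧ N.IsRational ∧
      (fun x => of piRep * x)^[k] (of r) - of N ∈ relations := by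
  obtain ⟨p, q, hp, hq, hpq⟩ := exists_sub_add_mem_relations_sign r
  obtain ⟨A, hAb, hA1, hpA⟩ := exists_boundedVolume_sub_mem_relations p hp
  obtain ⟨B, hBb, hB1, hqB⟩ := exists_boundedVolume_sub_mem_relations q hq
  obtain ⟨a, mA, NA, hNAd, hNAr, hNA⟩ := stub_volumePiBox _ A hAb hA1
  obtain ⟨b, mB, NB, hNBd, hNBr, hNB⟩ := stub_volumePiBox _ B hBb hB1
  -- common power `a + b`
  obtain ⟨mA', NA', hNA'd, hNA'r, hNA'⟩ := exists_boxRat_piPow b mA NA hNAd hNAr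
  obtain ⟨mB', NB', hNB'd, hNB'r, hNB'⟩ := exists_boxRat_piPow a mB NB hNBd hNBr
  obtain ⟨k, M, hMd, hMr, hM⟩ := stub_boxCombine mA' mB' NA' NB' hNA'd hNA'r hNB'd hNB'r
  refine ⟨a + b, k, M, hMd, hMr, ?_⟩
  -- `[π]^(a+b)[p] ≡ NA'`
  have hP : (fun x => of piRep * x)^[(a + b)] (of p) - of NA' ∈ relations := by
    rw [Nat.add_comm, piPow_add]
    have h1 : (fun x => of piRep * x)^[b] ((fun x => of piRep * x)^[a] (of p)) - (fun x => of piRep * x)^[b] (of NA) ∈ relations :=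
      piPow_congr b (by
        have := relations.add_mem (piPow_congr a hpA) hNA
        rwa [sub_add_sub_cancel] at this)
    have := relations.add_mem h1 hNA'
    rwa [sub_add_sub_cancel] at this
  -- `[π]^(a+b)[q] ≡ NB'`
  have hQ : (fun x => of piRep * x)^[(a + b)] (of q) - of NB' ∈ relations := by
    rw [piPow_add]
    have h1 : (fun x => of piRep * x)^[a] ((fun x => of piRep * x)^[b] (of q)) - (fun x => of piRep * x)^[a] (of NB) ∈ relations :=
      piPow_congr a (by
        have := relations.add_mem (piPow_congr b hqB) hNB
        rwa [sub_add_sub_cancel] at this)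
    have := relations.add_mem h1 hNB'
    rwa [sub_add_sub_cancel] at this
  -- `[π]^(a+b)[r] ≡ [π]^(a+b)([p] − [q])`
  have hR : (fun x => of piRep * x)^[(a + b)] (of r) - (fun x => of piRep * x)^[(a + b)] (of p - of q) ∈ relations := by
    rw [← piPow_sub]
    refine piRep_mul_iterate_mem_relations _ ?_
    have : of r - (of p - of q) = of r - of p + of q := by abel
    rwa [this]
  have : (fun x => of piRep * x)^[(a + b)] (of r) - of M = ((fun x => of piRep * x)^[(a + b)] (of r) - (fun x => of piRep * x)^[(a + b)] (of p - of q)) +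
      (((fun x => of piRep * x)^[(a + b)] (of p) - of NA') - ((fun x => of piRep * x)^[(a + b)] (of q) - of NB')) +
      (of NA' - of NB' - of M) := by
    rw [piPow_sub]; abel
  rw [this]
  exact relations.add_mem (relations.add_mem hR (relations.sub_mem hP hQ)) hM

/-! ## The transfer theorem -/

/-- **The transfer theorem of the line (sorry-free): `BoxRigidity → PiCancellation → Conjecture 1`.**
`PiBoxReduction` on both representations (`exists_boxRat_piPow_sub`), a common power of `[π]`
(`exists_boxRat_piPow`), equal values by soundness (`eval ([π]^T·[r]) = π^T · value r`), box
rigidity, and `PiCancellation` peels `[π]^T`. [cite: KontsevichZagier2001, §1.2  Conjecture 1] -/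
theorem statement_of_leaves
    (hrig : ∀ (m m' : ℕ) (N : IntegralRep m) (N' : IntegralRep m'),
      N.domain = {x | ∀ i, x i ∈ Set.Ioo (0:ℝ) 1} → N.IsRational →
      N'.domain = {x | ∀ i, x i ∈ Set.Ioo (0:ℝ) 1} → N'.IsRational →
      N.value = N'.value → Equivalent N N')
    (hpc : PiCancellation) : KontsevichZagierPeriods := by
  rw [KontsevichZagierPeriods_iff]
  intro n m r r' _ _ hv
  obtain ⟨S, m₁, M, hMd, hMr, hM⟩ := exists_boxRat_piPow_sub r
  obtain ⟨S', m₁', M', hM'd, hM'r, hM'⟩ := exists_boxRat_piPow_sub r'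
  obtain ⟨k, M₁, hM₁d, hM₁r, hM₁⟩ := exists_boxRat_piPow S' m₁ M hMd hMr
  obtain ⟨k', M₁', hM₁'d, hM₁'r, hM₁'⟩ := exists_boxRat_piPow S m₁' M' hM'd hM'r
  -- `[π]^(S'+S)[r] ≡ [M₁]`, `[π]^(S'+S)[r'] ≡ [M₁']`
  have h1 : (fun x => of piRep * x)^[(S' + S)] (of r) - of M₁ ∈ relations := by
    rw [piPow_add]
    have := relations.add_mem (piPow_congr S' hM) hM₁
    rwa [sub_add_sub_cancel] at this
  have h2 : (fun x => of piRep * x)^[(S' + S)] (of r') - of M₁' ∈ relations := by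
    rw [Nat.add_comm, piPow_add]
    have := relations.add_mem (piPow_congr S hM') hM₁'
    rwa [sub_add_sub_cancel] at this
  -- values
  have hval : M₁.value = M₁'.value := by
    have e1 := relations_le_ker_eval_holds h1
    have e2 := relations_le_ker_eval_holds h2
    rw [AddMonoidHom.mem_ker, map_sub, eval_piPow, eval_of, eval_of, sub_eq_zero] at e1 e2
    rw [← e1, ← e2, hv]
  -- rigidity, then cancellation
  have hMM : of M₁ - of M₁' ∈ relations := hrig k k' M₁ M₁' hM₁d hM₁r hM₁'d hM₁'r hval
  have h3 : (fun x => of piRep * x)^[(S' + S)] (of r - of r') ∈ relations := by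
    rw [piPow_sub]
    have : (fun x => of piRep * x)^[(S' + S)] (of r) - (fun x => of piRep * x)^[(S' + S)] (of r') =
        ((fun x => of piRep * x)^[(S' + S)] (of r) - of M₁) + (of M₁ - of M₁') - ((fun x => of piRep * x)^[(S' + S)] (of r') - of M₁') := by
      abel
    rw [this]
    exact relations.sub_mem (relations.add_mem h1 hMM) h2
  exact mem_of_piPow_mem hpc _ h3

/-- **Conversely, Conjecture 1 gives both leaves**: box-rational representations are rational
representations (so `BoxRigidity` is a special case of the Statement), and `PiCancellation` follows
from the kernel form of Conjecture 1 by soundness (`KZ.piCancellation_of_kernel`,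
`kzKernelConjecture_iff_isRational`). [cite: KontsevichZagier2001, §1.2  Conjecture 1] -/
theorem leaves_of_statement (h : KontsevichZagierPeriods) :
    (∀ (m m' : ℕ) (N : IntegralRep m) (N' : IntegralRep m'),
      N.domain = {x | ∀ i, x i ∈ Set.Ioo (0:ℝ) 1} → N.IsRational →
      N'.domain = {x | ∀ i, x i ∈ Set.Ioo (0:ℝ) 1} → N'.IsRational →
      N.value = N'.value → Equivalent N N') ∧ PiCancellation := by
  have h' := KontsevichZagierPeriods_iff.1 h
  refine ⟨fun m m' N N' _ hNr _ hN'r hv => h' N N' hNr hN'r hv, ?_⟩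
  exact piCancellation_of_kernel relations_le_ker_eval_holds
    (kzKernelConjecture_iff_isRational.2 h')

/-- **Summit ⟺ BoxRigidity ∧ PiCancellation** (the honest strength of the line's residual: jointly
EXACTLY the Statement; what the reduction removes from Conjecture 1 is geometry, not arithmetic).
[cite: KontsevichZagier2001, §1.2  Conjecture 1] -/
theorem statement_iff_leaves :
    KontsevichZagierPeriods ↔
    ((∀ (m m' : ℕ) (N : IntegralRep m) (N' : IntegralRep m'),
      N.domain = {x | ∀ i, x i ∈ Set.Ioo (0:ℝ) 1} → N.IsRational →
      N'.domain = {x | ∀ i, x i ∈ Set.Ioo (0:ℝ) 1} → N'.IsRational →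
      N.value = N'.value → Equivalent N N') ∧ PiCancellation) :=
  ⟨leaves_of_statement, fun h => statement_of_leaves h.1 h.2⟩

/-! ## Cycle 2 (lead prover-line-stmt-KontsevichZagierPeriods-3869-1): formal combinations,
BoxRigidity ⟺ BoxVanishing, BoxRigidity ⇒ `KZ.PiLocalKernel`, and the crux from the leaves -/

section CycleTwo

open Summit.KontsevichZagierPeriods.KontsevichZagierPeriods.Theses.HurwitzMicroSectors
  (NormalFormPrinciple)

/-! ## Box-rational models of FORMAL combinations; BoxRigidity ⇒ BoxVanishing ⇒ PiLocalKernel -/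

/-- The negative of a box-rational representation is box-rational and cancels it modulo
relations (`[N] + [N.neg] ∈ relations`). [folklore] -/
theorem boxRat_neg (N : IntegralRep m) (hNd : N.domain = {x | ∀ i, x i ∈ Set.Ioo (0:ℝ) 1})
    (hNr : N.IsRational) :
    N.neg.domain = {x | ∀ i, x i ∈ Set.Ioo (0:ℝ) 1} ∧ N.neg.IsRational ∧ of N + of N.neg ∈ relations := by
  obtain ⟨p, q, hq, he⟩ := hNr
  refine ⟨hNd, ⟨-p, q, fun x hx => hq x hx, fun x hx => ?_⟩,
    of_add_of_mem_relations_of_eqOn_neg rfl fun x _ => rfl⟩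
  simp only [IntegralRep.integrand_neg, Pi.neg_apply, map_neg, neg_div]
  exact congrArg Neg.neg (he hx)

/-- **Sums of box-rational representations are box-rational** (pad to a common box,
`stub_boxCombine` against the negative). [cite: KontsevichZagier2001, §1.2] -/
theorem exists_boxRat_add {a b : ℕ} (M₁ : IntegralRep a) (M₂ : IntegralRep b)
    (h₁d : M₁.domain = {x | ∀ i, x i ∈ Set.Ioo (0:ℝ) 1}) (h₁r : M₁.IsRational)
    (h₂d : M₂.domain = {x | ∀ i, x i ∈ Set.Ioo (0:ℝ) 1}) (h₂r : M₂.IsRational) :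
    ∃ (k : ℕ) (M : IntegralRep k), M.domain = {x | ∀ i, x i ∈ Set.Ioo (0:ℝ) 1} ∧ M.IsRational ∧
      of M₁ + of M₂ - of M ∈ relations := by
  obtain ⟨hnd, hnr, hn⟩ := boxRat_neg M₂ h₂d h₂r
  obtain ⟨k, M, hMd, hMr, hM⟩ := stub_boxCombine a b M₁ M₂.neg h₁d h₁r hnd hnr
  refine ⟨k, M, hMd, hMr, ?_⟩
  have e : of M₁ + of M₂ - of M = (of M₁ - of M₂.neg - of M) + (of M₂ + of M₂.neg) := by abel
  rw [e]
  exact relations.add_mem hM hn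

/-- `[π]^k·(−c) = −[π]^k·c`. [folklore] -/
theorem piPow_neg (k : ℕ) (c : FormalRep) :
    (fun x => of piRep * x)^[k] (-c) = -(fun x => of piRep * x)^[k] c := by
  have := piPow_sub k 0 c
  rwa [zero_sub, piPow_zero_right, zero_sub] at this

/-- **PiBoxReduction for formal combinations**: every `c : FormalRep` has `k`, `m` and a
box-rational `N` with `[π]^k·c − [N] ∈ KZ.relations` (generators: `exists_boxRat_piPow_sub`;
closed under `−` and `+` by `boxRat_neg`, a common power and `exists_boxRat_add`).
[cite: KontsevichZagier2001, §1.2] -/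
theorem exists_boxRat_piPow_sub_formal (c : FormalRep) :
    ∃ (k m : ℕ) (N : IntegralRep m), N.domain = {x | ∀ i, x i ∈ Set.Ioo (0:ℝ) 1} ∧ N.IsRational ∧
      (fun x => of piRep * x)^[k] c - of N ∈ relations := by
  induction c using FreeAbelianGroup.induction_on with
  | zero =>
    obtain ⟨Z, hZd, hZi⟩ := exists_zeroRep (isSemialgebraic_box 0)
    refine ⟨0, 0, Z, hZd, ⟨0, 1, fun x _ => by simp, fun x _ => by simp [hZi]⟩, ?_⟩
    have hZ : of Z ∈ relations := of_mem_relations_of_eqOn_zero Z (by simp [hZi, EqOn])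
    simpa using relations.neg_mem hZ
  | of s =>
    obtain ⟨n, r⟩ := s
    obtain ⟨k, m, N, hNd, hNr, hN⟩ := exists_boxRat_piPow_sub r
    exact ⟨k, m, N, hNd, hNr, hN⟩
  | neg s ih =>
    obtain ⟨k, m, N, hNd, hNr, hN⟩ := ih
    obtain ⟨hnd, hnr, hn⟩ := boxRat_neg N hNd hNr
    refine ⟨k, m, N.neg, hnd, hnr, ?_⟩
    rw [piPow_neg]
    have e : -(fun x => of piRep * x)^[k] (FreeAbelianGroup.of s) - of N.neg =
        -((fun x => of piRep * x)^[k] (FreeAbelianGroup.of s) - of N) - (of N + of N.neg) := by abel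
    rw [e]
    exact relations.sub_mem (relations.neg_mem hN) hn
  | add x y hx hy =>
    obtain ⟨k₁, m₁, N₁, h₁d, h₁r, h₁⟩ := hx
    obtain ⟨k₂, m₂, N₂, h₂d, h₂r, h₂⟩ := hy
    obtain ⟨m₁', N₁', h₁'d, h₁'r, h₁'⟩ := exists_boxRat_piPow k₂ m₁ N₁ h₁d h₁r
    obtain ⟨m₂', N₂', h₂'d, h₂'r, h₂'⟩ := exists_boxRat_piPow k₁ m₂ N₂ h₂d h₂r
    obtain ⟨k, M, hMd, hMr, hM⟩ := exists_boxRat_add N₁' N₂' h₁'d h₁'r h₂'d h₂'r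
    refine ⟨k₂ + k₁, k, M, hMd, hMr, ?_⟩
    have e1 : (fun x => of piRep * x)^[k₂ + k₁] x - of N₁' ∈ relations := by
      rw [piPow_add]
      have e : (fun x => of piRep * x)^[k₂] ((fun x => of piRep * x)^[k₁] x) - of N₁' =
          ((fun x => of piRep * x)^[k₂] ((fun x => of piRep * x)^[k₁] x) -
            (fun x => of piRep * x)^[k₂] (of N₁)) +
          ((fun x => of piRep * x)^[k₂] (of N₁) - of N₁') := by abel
      rw [e]
      exact relations.add_mem (piPow_congr k₂ h₁) h₁'
    have e2 : (fun x => of piRep * x)^[k₂ + k₁] y - of N₂' ∈ relations := by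
      rw [Nat.add_comm, piPow_add]
      have e : (fun x => of piRep * x)^[k₁] ((fun x => of piRep * x)^[k₂] y) - of N₂' =
          ((fun x => of piRep * x)^[k₁] ((fun x => of piRep * x)^[k₂] y) -
            (fun x => of piRep * x)^[k₁] (of N₂)) +
          ((fun x => of piRep * x)^[k₁] (of N₂) - of N₂') := by abel
      rw [e]
      exact relations.add_mem (piPow_congr k₁ h₂) h₂'
    rw [piPow_add_distrib]
    have e : (fun x => of piRep * x)^[k₂ + k₁] x + (fun x => of piRep * x)^[k₂ + k₁] y - of M =
        ((fun x => of piRep * x)^[k₂ + k₁] x - of N₁') +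
        ((fun x => of piRep * x)^[k₂ + k₁] y - of N₂') + (of N₁' + of N₂' - of M) := by abel
    rw [e]
    exact relations.add_mem (relations.add_mem e1 e2) hM

/-- **BoxRigidity ⇒ BoxVanishing**: under BoxRigidity a box-rational representation with value
`0` is a relation (compare it with the zero representation on its box). [folklore] -/
theorem boxVanishing_of_boxRigidity
    (hrig : ∀ (m m' : ℕ) (N : IntegralRep m) (N' : IntegralRep m'),
      N.domain = {x | ∀ i, x i ∈ Set.Ioo (0:ℝ) 1} → N.IsRational →
      N'.domain = {x | ∀ i, x i ∈ Set.Ioo (0:ℝ) 1} → N'.IsRational →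
      N.value = N'.value → Equivalent N N')
    (N : IntegralRep m) (hNd : N.domain = {x | ∀ i, x i ∈ Set.Ioo (0:ℝ) 1}) (hNr : N.IsRational)
    (hv : N.value = 0) : of N ∈ relations := by
  obtain ⟨Z, hZd, hZi⟩ := exists_zeroRep (isSemialgebraic_box m)
  have hZ : of Z ∈ relations := of_mem_relations_of_eqOn_zero Z (by simp [hZi, EqOn])
  have hZv : Z.value = 0 := by simp [IntegralRep.value, hZi]
  have hZr : Z.IsRational := ⟨0, 1, fun x _ => by simp, fun x _ => by simp [hZi]⟩
  have h : of N - of Z ∈ relations := hrig m m N Z hNd hNr hZd hZr (by rw [hv, hZv])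
  simpa using relations.add_mem h hZ

/-- **BoxVanishing ⇒ BoxRigidity** (so the two are equivalent): the difference of two
box-rational representations is one box-rational representation modulo relations
(`stub_boxCombine`), of value `0` by soundness. [folklore] -/
theorem boxRigidity_of_boxVanishing
    (hvan : ∀ (m : ℕ) (N : IntegralRep m), N.domain = {x | ∀ i, x i ∈ Set.Ioo (0:ℝ) 1} →
      N.IsRational → N.value = 0 → of N ∈ relations) :
    ∀ (m m' : ℕ) (N : IntegralRep m) (N' : IntegralRep m'),
      N.domain = {x | ∀ i, x i ∈ Set.Ioo (0:ℝ) 1} → N.IsRational →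
      N'.domain = {x | ∀ i, x i ∈ Set.Ioo (0:ℝ) 1} → N'.IsRational →
      N.value = N'.value → Equivalent N N' := by
  intro m m' N N' hNd hNr hN'd hN'r hv
  obtain ⟨k, M, hMd, hMr, hM⟩ := stub_boxCombine m m' N N' hNd hNr hN'd hN'r
  have hMv : M.value = 0 := by
    have e := relations_le_ker_eval_holds hM
    rw [AddMonoidHom.mem_ker, map_sub, map_sub, eval_of, eval_of, eval_of, hv, sub_self,
      zero_sub, neg_eq_zero] at e
    exact e
  have := relations.add_mem hM (hvan k M hMd hMr hMv)
  rwa [sub_add_cancel] at this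

/-- **BoxRigidity ⇒ `KZ.PiLocalKernel`** (Ayoub's localised kernel conjecture for this calculus,
item stmt-KontsevichZagierPeriods-0541): a formal combination of value `0` has a box-rational model
`[π]^k·c ≡ [N]` (`exists_boxRat_piPow_sub_formal`) of value `π^k · 0 = 0`, which is a relation by
BoxVanishing. So the leaf sits between the summit and PiLocalKernel:
`KZKernelConjecture ⇒ BoxRigidity ⇒ PiLocalKernel`. [cite: Ayoub2014, Def. 6 and Conj. 7] -/
theorem piLocalKernel_of_boxRigidity
    (hrig : ∀ (m m' : ℕ) (N : IntegralRep m) (N' : IntegralRep m'),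
      N.domain = {x | ∀ i, x i ∈ Set.Ioo (0:ℝ) 1} → N.IsRational →
      N'.domain = {x | ∀ i, x i ∈ Set.Ioo (0:ℝ) 1} → N'.IsRational →
      N.value = N'.value → Equivalent N N') : PiLocalKernel := by
  intro c hc
  obtain ⟨k, m, N, hNd, hNr, hN⟩ := exists_boxRat_piPow_sub_formal c
  refine ⟨k, ?_⟩
  have hNv : N.value = 0 := by
    have e := relations_le_ker_eval_holds hN
    rw [AddMonoidHom.mem_ker, map_sub, eval_piPow, eval_of, hc, mul_zero, zero_sub,
      neg_eq_zero] at e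
    exact e
  have := relations.add_mem hN (boxVanishing_of_boxRigidity hrig N hNd hNr hNv)
  rwa [sub_add_cancel] at this

/-! ## The crux from the Statement and from the leaves -/

/-- **`KontsevichZagierPeriods → NormalFormPrinciple`** with `𝒩 :=` the representations of KZ's
rational shape: rigidity on `𝒩` is Conjecture 1 verbatim and reduction is the identity.
[cite: KontsevichZagier2001, §1.2 Conjecture 1] -/
theorem normalFormPrinciple_of_statement (h : _root_.KontsevichZagierPeriods) : NormalFormPrinciple := by
  rw [KontsevichZagierPeriods_iff] at h
  refine ⟨fun n => {r | r.IsRational}, fun n m N N' hN hN' hv => h N N' hN hN' hv,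
    fun n r hr => ⟨n, r, hr, Equivalent.refl r⟩⟩

/-- **The crux from the two leaves** (`BoxRigidity → PiCancellation → NormalFormPrinciple`, the
crux BY NAME; conditional on the line's two conjecture-grade stubs and on nothing else).
[cite: KontsevichZagier2001, §1.2 Conjecture 1] -/
theorem normalFormPrinciple_of_leaves
    (hrig : ∀ (m m' : ℕ) (N : IntegralRep m) (N' : IntegralRep m'),
      N.domain = {x | ∀ i, x i ∈ Set.Ioo (0:ℝ) 1} → N.IsRational →
      N'.domain = {x | ∀ i, x i ∈ Set.Ioo (0:ℝ) 1} → N'.IsRational →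
      N.value = N'.value → Equivalent N N')
    (hpc : PiCancellation) : NormalFormPrinciple :=
  normalFormPrinciple_of_statement (statement_of_leaves hrig hpc)

end CycleTwo

end Summit.KontsevichZagierPeriods.HurwitzMicroSectors.NormalFormPrinciple.PiBox
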